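import Summits.AtomisticToContinuum.Crystallization.Theorems.ChartedPlanarOrderProfileSlavingLJ

/-!
# D1 ALGEBRA over the landed PS node (decomp-a2c lens-3 g22): layer force balance ⇒ constant gap stress

Additive companion of the landed `…Theorems.ChartedPlanarOrderProfileSlavingLJ` (p819838): the ALGEBRAIC half of D1 `NashBalance` is proved here —
`NashBalance Λ ⟸ LayerForceBalance Λ (D1a, analytic) ∧ StraddleSummable Λ (D1s, tail bookkeeping)` (`nashBalance_of_layerForceBalance`), via Newton III
`layerForce_neg` (unconditional) and the straddle bookkeeping identity `gapStress_succ_sub : gapStress (m+1) − gapStress m = Σ_{l ≠ m} layerForce a b (w m − w l)`.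
Binder lists of D1a/D1s copy the landed `NashBalance` exactly (no independence binder: in the dependent case `layerForce` is a non-summable junk `0` or
the hypotheses are unsatisfiable — a prover may first derive `LinearIndependent ℝ ![a, b]` from `IsSep` + `IsClean` + `IsStacked`).

READING RULES (critic row 419 (1), recorded here since the node landed before the ruling): W `TubeMonotone Λ η` is read only for
`η < ½ · inf_m ⟨n, incr w m⟩/‖n‖` (half the smallest normal layer spacing; nearest-neighbour-period clean stackings have spacings `≥ 1/2`, so `η ≈ 1/50`
qualifies) — then every tube profile keeps consecutive layers strictly stacked and no pair term of `layerForce`/`gapStress` is evaluated at a lattice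
point; D1 evaluates `gapStress` at the configuration's OWN increments (layers pairwise disjoint), and the summability of the straddling family is D1s.
Def-bearing (Props `LayerForceBalance`, `StraddleSummable`; data defs `pairFamily`, the straddle sets, two `Equiv`s); no sorry.
-/

noncomputable section

open MeasureTheory Set Metric
open scoped RealInnerProductSpace
open Summit.AtomisticToContinuum.Crystallization.Theorems.ChartedPlanarOrderRigidityDoor
open Summit.AtomisticToContinuum.Crystallization.Theorems.ChartedPlanarOrderDensityDichotomy
open Summit.AtomisticToContinuum.Crystallization.Theorems.ChartedPlanarOrderMesoCut
open Summit.AtomisticToContinuum.Crystallization.Theorems.ChartedPlanarOrderDoorLayered (Layered)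
open Summit.AtomisticToContinuum.Crystallization.Theorems.ChartedPlanarOrderProfileSlavingLJ

namespace Summit.AtomisticToContinuum.Crystallization.Theorems.ChartedPlanarOrderProfileSlavingLJBalance

/-! ## The algebraic half of D1: layer force balance ⇒ constant gap stress (Newton III + straddle bookkeeping)

D1 splits as D1 ⟸ D1a «LayerForceBalance» (ANALYTIC: Nash ⇒ the net force on an atom of layer `m` from all other layers vanishes —
differentiability of the LJ site energy at a separated configuration, in-layer forces cancel by symmetry) ∧ D1s «StraddleSummable»
(the straddling family is summable — tail bound `|layerForce| ≲ height⁻⁵`) with the ALGEBRA proved here: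
`gapStress (m+1) − gapStress m = Σ_{l ≠ m} layerForce a b (w m − w l)` (`gapStress_succ_sub`), hence `nashBalance_of_layerForceBalance`. -/

/-- Newton III for the pair force. -/
theorem pairForce_neg (x : E3) : pairForce (-x) = -pairForce x := by
  simp only [pairForce, norm_neg, smul_neg]

/-- Newton III for the layer force (unconditional: the reflection `(i, j) ↦ (−i, −j)` is a bijection of `ℤ²`, junk values match). -/
theorem layerForce_neg (a b v : E3) : layerForce a b (-v) = -layerForce a b v := by
  unfold layerForce
  rw [← tsum_neg, ← (Equiv.neg (ℤ × ℤ)).tsum_eq]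
  refine tsum_congr fun ij => ?_
  rw [← pairForce_neg]
  congr 1
  simp only [Equiv.neg_apply, Prod.fst_neg, Prod.snd_neg, Int.cast_neg, neg_smul]
  abel

/-- the pair family `(k, l) ↦ layerForce a b (w k − w l)` on `ℤ²`. -/
def pairFamily (a b : E3) (w : ℤ → E3) (p : ℤ × ℤ) : E3 := layerForce a b (w p.1 - w p.2)

/-- the straddle set of gap `m` as a `Set (ℤ × ℤ)` (`Straddle m` is its subtype). -/
def straddleSet (m : ℤ) : Set (ℤ × ℤ) := {p | p.1 < m ∧ m ≤ p.2}

/-- the pairs straddling both gaps `m` and `m + 1`. -/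
def coreSet (m : ℤ) : Set (ℤ × ℤ) := {p | p.1 < m ∧ m < p.2}

/-- the pairs `(m, l)`, `l > m`. -/
def upSet (m : ℤ) : Set (ℤ × ℤ) := {p | p.1 = m ∧ m < p.2}

/-- the pairs `(k, m)`, `k < m`. -/
def downSet (m : ℤ) : Set (ℤ × ℤ) := {p | p.1 < m ∧ p.2 = m}

/-- the straddle set of gap `m + 1` splits into the core pairs and the up-pairs of `m`. -/
theorem straddleSet_succ (m : ℤ) : straddleSet (m + 1) = coreSet m ∪ upSet m := by
  ext p; simp only [straddleSet, coreSet, upSet, Set.mem_setOf_eq, Set.mem_union]; omega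

/-- the straddle set of gap `m` splits into the core pairs and the down-pairs of `m`. -/
theorem straddleSet_eq (m : ℤ) : straddleSet m = coreSet m ∪ downSet m := by
  ext p; simp only [straddleSet, coreSet, downSet, Set.mem_setOf_eq, Set.mem_union]; omega

/-- core pairs and up-pairs are disjoint. -/
theorem disjoint_core_up (m : ℤ) : Disjoint (coreSet m) (upSet m) := by
  rw [Set.disjoint_left]; intro p hp hp'; simp only [coreSet, upSet, Set.mem_setOf_eq] at hp hp'; omega

/-- core pairs and down-pairs are disjoint. -/
theorem disjoint_core_down (m : ℤ) : Disjoint (coreSet m) (downSet m) := by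
  rw [Set.disjoint_left]; intro p hp hp'; simp only [coreSet, downSet, Set.mem_setOf_eq] at hp hp'; omega

/-- the straddling sum at the own increment profile, read through the dictionary as a set-indexed sum of the pair family. -/
theorem gapStress_incr_eq (a b : E3) (w : ℤ → E3) (m : ℤ) :
    gapStress a b m (incr w) = ∑' p : straddleSet m, pairFamily a b w p := by
  unfold gapStress
  show ∑' p : Straddle m, layerForce a b (-offsetOf (incr w) p.1.1 p.1.2) = ∑' p : Straddle m, layerForce a b (w p.1.1 - w p.1.2)
  refine tsum_congr fun p => ?_
  rw [offsetOf_incr w (le_trans p.2.1.le p.2.2), neg_sub]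

/-- restriction of set-summability to a subset. -/
theorem summable_subset {ι : Type} {f : ι → E3} {s t : Set ι} (h : s ⊆ t) (ht : Summable (f ∘ (↑) : t → E3)) :
    Summable (f ∘ (↑) : s → E3) :=
  ht.comp_injective (Set.inclusion_injective h)

/-- `upSet m ≃ {l // m < l}`. -/
def upEquiv (m : ℤ) : {l : ℤ // m < l} ≃ upSet m where
  toFun l := ⟨(m, l.1), ⟨rfl, l.2⟩⟩
  invFun p := ⟨p.1.2, p.2.2⟩
  left_inv l := rfl
  right_inv p := by
    obtain ⟨⟨k, l⟩, hk, hl⟩ := p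
    cases hk
    rfl

/-- `downSet m ≃ {k // k < m}`. -/
def downEquiv (m : ℤ) : {k : ℤ // k < m} ≃ downSet m where
  toFun k := ⟨(k.1, m), ⟨k.2, rfl⟩⟩
  invFun p := ⟨p.1.1, p.2.1⟩
  left_inv k := rfl
  right_inv p := by
    obtain ⟨⟨k, l⟩, hk, hl⟩ := p
    cases hl
    rfl

/-- the pair family summed over the up-pairs of `m` is the upward layer force at `m`. -/
theorem tsum_upSet (a b : E3) (w : ℤ → E3) (m : ℤ) :
    ∑' p : upSet m, pairFamily a b w p = ∑' l : {l : ℤ // m < l}, layerForce a b (w m - w l) := by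
  rw [← (upEquiv m).tsum_eq]; rfl

/-- the pair family summed over the down-pairs of `m` is minus the downward layer force at `m`. -/
theorem tsum_downSet (a b : E3) (w : ℤ → E3) (m : ℤ) :
    ∑' p : downSet m, pairFamily a b w p = -∑' k : {k : ℤ // k < m}, layerForce a b (w m - w k) := by
  rw [← (downEquiv m).tsum_eq, ← tsum_neg]
  refine tsum_congr fun k => ?_
  show layerForce a b (w k.1 - w m) = -layerForce a b (w m - w k.1)
  rw [← layerForce_neg, neg_sub]

/-- splitting the layer-`m` family into the layers above and below. -/
theorem tsum_ne_split (a b : E3) (w : ℤ → E3) (m : ℤ) (hF : Summable (fun l : {l : ℤ // l ≠ m} => layerForce a b (w m - w l))) :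
    ∑' l : {l : ℤ // l ≠ m}, layerForce a b (w m - w l)
      = ∑' l : {l : ℤ // m < l}, layerForce a b (w m - w l) + ∑' k : {k : ℤ // k < m}, layerForce a b (w m - w k) := by
  have hsplit : ({l : ℤ | l ≠ m} : Set ℤ) = {l | m < l} ∪ {l | l < m} := by
    ext l; simp only [Set.mem_setOf_eq, Set.mem_union]; omega
  have hdis : Disjoint ({l : ℤ | m < l}) ({l : ℤ | l < m}) := by
    rw [Set.disjoint_left]; intro l hl hl'; simp only [Set.mem_setOf_eq] at hl hl'; omega
  have hF' : Summable ((fun l : ℤ => layerForce a b (w m - w l)) ∘ (↑) : ({l : ℤ | l ≠ m} : Set ℤ) → E3) := hF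
  have h1 : ({l : ℤ | m < l} : Set ℤ) ⊆ {l | l ≠ m} := fun l hl => by simp only [Set.mem_setOf_eq] at hl ⊢; omega
  have h2 : ({l : ℤ | l < m} : Set ℤ) ⊆ {l | l ≠ m} := fun l hl => by simp only [Set.mem_setOf_eq] at hl ⊢; omega
  have hGs : Summable ((fun l : ℤ => layerForce a b (w m - w l)) ∘ (↑) : ({l : ℤ | m < l} : Set ℤ) → E3) := summable_subset h1 hF'
  have hLs : Summable ((fun l : ℤ => layerForce a b (w m - w l)) ∘ (↑) : ({l : ℤ | l < m} : Set ℤ) → E3) := summable_subset h2 hF'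
  have := Summable.tsum_union_disjoint hdis hGs hLs
  rw [← hsplit] at this
  exact this

/-- **the straddle bookkeeping identity**: `gapStress (m+1) − gapStress m = Σ_{l ≠ m} layerForce a b (w m − w l)`, given summability of the
two straddling families and of the layer-`m` family. -/
theorem gapStress_succ_sub (a b : E3) (w : ℤ → E3) (m : ℤ)
    (hm : Summable (pairFamily a b w ∘ (↑) : straddleSet m → E3))
    (hm1 : Summable (pairFamily a b w ∘ (↑) : straddleSet (m + 1) → E3))
    (hF : Summable (fun l : {l : ℤ // l ≠ m} => layerForce a b (w m - w l))) :
    gapStress a b (m + 1) (incr w) - gapStress a b m (incr w) = ∑' l : {l : ℤ // l ≠ m}, layerForce a b (w m - w l) := by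
  have hCs : Summable (pairFamily a b w ∘ (↑) : coreSet m → E3) :=
    summable_subset (by rw [straddleSet_eq]; exact Set.subset_union_left) hm
  have hAs : Summable (pairFamily a b w ∘ (↑) : upSet m → E3) :=
    summable_subset (by rw [straddleSet_succ]; exact Set.subset_union_right) hm1
  have hBs : Summable (pairFamily a b w ∘ (↑) : downSet m → E3) :=
    summable_subset (by rw [straddleSet_eq]; exact Set.subset_union_right) hm
  rw [gapStress_incr_eq, gapStress_incr_eq, straddleSet_succ, straddleSet_eq,
    Summable.tsum_union_disjoint (disjoint_core_up m) hCs hAs, Summable.tsum_union_disjoint (disjoint_core_down m) hCs hBs,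
    tsum_upSet, tsum_downSet, tsum_ne_split a b w m hF]
  abel

/-- **D1a «LayerForceBalance Λ»** (S/M · TRUE? — the ANALYTIC half of D1): in a clean separated single-site-Nash stacked layered LJ configuration
with in-plane periods of norm `≤ Λ`, the net force on an atom of layer `m` exerted by all OTHER layers vanishes, as a convergent sum
(Nash ⇒ local minimality of the site energy ⇒ zero gradient, by differentiability of the LJ site sum at a `δ`-separated configuration; the
in-layer contribution cancels by the symmetry `(i, j) ↦ (−i, −j)`, `layerForce_neg`). -/
def LayerForceBalance (Λ : ℝ) : Prop :=
  ∀ δ : ℝ, 0 < δ → ∀ (a b : E3) (w : ℤ → E3), ‖a‖ ≤ Λ → ‖b‖ ≤ Λ →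
    IsSep δ (Layered a b w) → IsClean (μS (Layered a b w)) → IsNash (μS (Layered a b w)) → IsStacked a b w →
    ∀ m : ℤ, HasSum (fun l : {l : ℤ // l ≠ m} => layerForce a b (w m - w l)) 0

/-- **D1s «StraddleSummable Λ»** (S · TRUE-type — LJ tail bookkeeping): the straddling family of every gap is summable (`|layerForce a b v|
≲ height(v)⁻⁵`, and heights grow linearly in the layer index by separation). -/
def StraddleSummable (Λ : ℝ) : Prop :=
  ∀ δ : ℝ, 0 < δ → ∀ (a b : E3) (w : ℤ → E3), ‖a‖ ≤ Λ → ‖b‖ ≤ Λ →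
    IsSep δ (Layered a b w) → IsClean (μS (Layered a b w)) → IsNash (μS (Layered a b w)) → IsStacked a b w →
    ∀ m : ℤ, Summable (pairFamily a b w ∘ (↑) : straddleSet m → E3)

/-- ★ **D1 ⟸ D1a ∧ D1s** (the algebra of D1, PROVED): layer force balance + straddle summability ⇒ constant transmitted stress. -/
theorem nashBalance_of_layerForceBalance {Λ : ℝ} (hA : LayerForceBalance Λ) (hS : StraddleSummable Λ) : NashBalance Λ := by
  intro δ hδ a b w ha hb hs hc hn hst
  have step : ∀ m : ℤ, gapStress a b (m + 1) (incr w) = gapStress a b m (incr w) := fun m => by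
    have h := gapStress_succ_sub a b w m (hS δ hδ a b w ha hb hs hc hn hst m) (hS δ hδ a b w ha hb hs hc hn hst (m + 1))
      (hA δ hδ a b w ha hb hs hc hn hst m).summable
    rw [(hA δ hδ a b w ha hb hs hc hn hst m).tsum_eq] at h
    exact sub_eq_zero.mp h
  refine ⟨gapStress a b 0 (incr w), fun m => ?_⟩
  induction m using Int.induction_on with
  | zero => rfl
  | succ n ih => rw [step, ih]
  | pred n ih =>
    have := step (-(n : ℤ) - 1)
    rw [sub_add_cancel] at this
    rw [← ih, ← this]

end Summit.AtomisticToContinuum.Crystallization.Theorems.ChartedPlanarOrderProfileSlavingLJBalance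

end
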